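import Literature.RepresentationTheory.Kovacevic2021.SU21PrincipalSeriesCompositionFactors
import Literature.RepresentationTheory.Kovacevic2021.SU21HolomorphicCompositionFactors
import Literature.RepresentationTheory.Kovacevic2021.SU21SubquotientModule
import Literature.Algebra.Lie.LieSubmoduleJordanHolder
import HarnessLib

/-!
# Jordan–Hölder for Kovačević's `V(0,0)`, `V(−3/2, ±6)`: their series are composition series in Mathlib's sense,
# of lengths `4`, `3`, `3`

This file restates the composition structure of Kovačević's principal-series data [Kovacevic2021, §3 Thm 3, Remark 6]
in the vocabulary of Mathlib's abstract Jordan–Hölder theory (`CompositionSeries`, `CompositionSeries.jordan_holder`),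
made available for modules over a Lie algebra by `Literature.Algebra.Lie.LieSubmoduleJordanHolder`
(`IsMaximal N N' := N ⋖ N'`; `N ⋖ N' ↔` the subquotient `N' ⧸ N` is irreducible):

* §1 for a datum `𝒟` and Lie submodules `N₁ ≤ N₂ ⊆ 𝒟.V`: **`N₁ ⋖ N₂` iff the subquotient datum
  `𝒟.subquotient N₁ N₂` has an irreducible module** (`covBy_iff_subquotient_isIrreducible`; the module of the subquotient
  datum IS `N₂ ⧸ N₁`, `SU21SubquotientModule.sqEquiv`);
* §2 **the cohomological points**: the chains `⊥ ⋖ N_v ⋖ N_row ⋖ N_row ⊔ N_col ⋖ V(0,0)` (`rhoCompositionSeries`),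
  `⊥ ⋖ N_ray ⋖ N_strip ⋖ V(−3/2,6)` (`holCompositionSeries`), `⊥ ⋖ N_ray' ⋖ N_strip' ⋖ V(−3/2,−6)`
  (`antiholCompositionSeries`) of `SU21PrincipalSeriesCompositionFactors` / `SU21HolomorphicCompositionFactors` are
  `CompositionSeries` (each step is covering because its subquotient `J_{0,0}, J_{1,0}, J_{0,1}, D_1`, resp.
  `D_2, J_{1,0}, D_1`, resp. `D_0, J_{0,1}, D_1` is irreducible), hence by Jordan–Hölder **every composition series of
  `V(0,0)` has length `4`, of `V(−3/2,±6)` length `3`** (`principalSeries_zero_zero_compositionSeries_length_eq`, …) —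
  [BorelWallach2000, VI 4.10 (10)] in its invariant form.  (Every `V(c,2t)` has SOME composition series — its submodule
  lattice is finite, `SU21PrincipalSeriesSubmoduleLattice` — see the sequel `SU21PrincipalSeriesFiniteLength`.)

## References

* A. Borel, N. Wallach (2000), VI 4.10 (10) p. 132. [BorelWallach2000]
* D. Kovačević, *Unitary `(𝔤,K)` modules of `SU(2,1)`*, Acta Math. Spalatensia 1 (2021) 105–125, §3 Thm 3,
  Remark 6, §4. [Kovacevic2021]
* N. Bourbaki, *Algebra I*, Chap. I §4 no. 7 (Jordan–Hölder for groups with operators). [BourbakiAlgebraI1989]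
-/

noncomputable section

namespace Literature.RepresentationTheory.Kovacevic2021

-- Mathlib idiom (Mathlib/Algebra/Lie/OfAssociative.lean): commutator brackets on associative algebras; needed for
-- the `𝔤𝔩(3,ℂ)`-module structure on `𝒟.V`, as in every file of this directory.
attribute [local instance 100] LieRing.ofAssociativeRing

namespace SU21Datum

open PrincipalSeries Literature.Algebra.Lie

/-! ## §1 Covering pairs of Lie submodules of a datum = irreducible subquotient data -/

/-- **`N₁ ⋖ N₂` iff the module of the subquotient datum `𝒟.subquotient N₁ N₂` (which is `N₂ ⧸ N₁`) is irreducible**,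
for Lie submodules `N₁ ≤ N₂` of the module of a `K`-type datum.
[cite: Kovacevic2021, §3 Remark 6] [cite: BourbakiAlgebraI1989, Chap. I §4 no. 7 Prop. 9] -/
theorem covBy_iff_subquotient_isIrreducible {𝒟 : SU21Datum}
    {N₁ N₂ : LieSubmodule ℂ (Matrix (Fin 3) (Fin 3) ℂ) 𝒟.V} (hle : N₁ ≤ N₂) :
    N₁ ⋖ N₂ ↔ LieModule.IsIrreducible ℂ (Matrix (Fin 3) (Fin 3) ℂ) (𝒟.subquotient N₁ N₂).V := by
  rw [covBy_iff_isIrreducible, and_iff_right hle, ← ker_sqHom]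
  exact (LieSubmodule.orderIsoMapComap (𝒟.sqEquiv N₁ N₂)).isSimpleOrder_iff

/-- an irreducible subquotient datum makes the pair covering [cite: Kovacevic2021, §3 Remark 6] -/
theorem covBy_of_subquotient_isIrreducible {𝒟 : SU21Datum}
    {N₁ N₂ : LieSubmodule ℂ (Matrix (Fin 3) (Fin 3) ℂ) 𝒟.V} (hle : N₁ ≤ N₂)
    (h : LieModule.IsIrreducible ℂ (Matrix (Fin 3) (Fin 3) ℂ) (𝒟.subquotient N₁ N₂).V) : N₁ ⋖ N₂ :=
  (covBy_iff_subquotient_isIrreducible hle).2 h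

/-! ## §2 The composition series of `V(0,0)`, `V(−3/2, 6)`, `V(−3/2, −6)` -/

/-- `N_v ≤ N_row` [cite: Kovacevic2021, §4] -/
theorem span00Vertex_le_span00Row : span00Vertex ≤ span00Row := by
  rw [span00Vertex, LieSubmodule.lieSpan_le, Set.singleton_subset_iff, SetLike.mem_coe, span00Row,
    principalSeries_zero_zero_vec_mem_lieSpan_iff_of_q_zero le_rfl le_rfl le_rfl]

/-- `N_v ≤ N_col` [cite: Kovacevic2021, §4] -/
theorem span00Vertex_le_span00Col : span00Vertex ≤ span00Col := by
  rw [span00Vertex, LieSubmodule.lieSpan_le, Set.singleton_subset_iff, SetLike.mem_coe, span00Col,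
    principalSeries_zero_zero_vec_mem_lieSpan_iff_of_p_zero le_rfl le_rfl le_rfl]

/-- `N_ray ≤ N_strip` [cite: Kovacevic2021, §4] -/
theorem spanHolRay_le_spanHolStrip : spanHolRay ≤ spanHolStrip := by
  rw [spanHolRay, LieSubmodule.lieSpan_le, Set.singleton_subset_iff, SetLike.mem_coe, spanHolStrip,
    principalSeries_hol_vec_mem_lieSpan_iff le_rfl zero_le_one le_rfl le_rfl]
  exact Or.inl zero_le_one

/-- `N_ray' ≤ N_strip'` [cite: Kovacevic2021, §4] -/
theorem spanAntiholRay_le_spanAntiholStrip : spanAntiholRay ≤ spanAntiholStrip := by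
  rw [spanAntiholRay, LieSubmodule.lieSpan_le, Set.singleton_subset_iff, SetLike.mem_coe, spanAntiholStrip,
    principalSeries_antihol_vec_mem_lieSpan_iff zero_le_one le_rfl le_rfl le_rfl]
  exact Or.inl zero_le_one


/-- `0 ⋖ N_v` (factor `J_{0,0}`) [cite: BorelWallach2000, VI 4.10 (10)] -/
theorem bot_covBy_span00Vertex :
    (⊥ : LieSubmodule ℂ (Matrix (Fin 3) (Fin 3) ℂ) (principalSeries 0 0).V) ⋖ span00Vertex :=
  covBy_of_subquotient_isIrreducible bot_le rho_vertex_factor.2.1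

/-- `N_v ⋖ N_row` (factor `J_{1,0}`) [cite: BorelWallach2000, VI 4.10 (10)] -/
theorem span00Vertex_covBy_span00Row : span00Vertex ⋖ span00Row :=
  covBy_of_subquotient_isIrreducible span00Vertex_le_span00Row rho_row_factor.2.1

/-- `N_v ⋖ N_col` (factor `J_{0,1}`) [cite: BorelWallach2000, VI 4.10 (10)] -/
theorem span00Vertex_covBy_span00Col : span00Vertex ⋖ span00Col :=
  covBy_of_subquotient_isIrreducible span00Vertex_le_span00Col rho_col_factor.2.1

/-- `N_row ⋖ N_row + N_col` (factor `J_{0,1}`) [cite: BorelWallach2000, VI 4.10 (10)] -/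
theorem span00Row_covBy_sup : span00Row ⋖ span00Row ⊔ span00Col :=
  covBy_of_subquotient_isIrreducible le_sup_left rho_join_factor.2.1

/-- `N_row + N_col ⋖ V(0,0)` (factor `D_1`) [cite: BorelWallach2000, VI 4.10 (10)] -/
theorem span00_sup_covBy_top :
    span00Row ⊔ span00Col ⋖ (⊤ : LieSubmodule ℂ (Matrix (Fin 3) (Fin 3) ℂ) (principalSeries 0 0).V) :=
  covBy_of_subquotient_isIrreducible le_top rho_top_factor.2.1

/-- **The composition series `0 ⋖ N_v ⋖ N_row ⋖ N_row + N_col ⋖ V(0,0)`** of the principal series at `ρ`, with factors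
`J_{0,0}, J_{1,0}, J_{0,1}, D_1` (`SU21PrincipalSeriesCompositionFactors`), as a `CompositionSeries` of Lie submodules.
[cite: BorelWallach2000, VI 4.10 (10)] [cite: Kovacevic2021, §4] -/
def rhoCompositionSeries : CompositionSeries (LieSubmodule ℂ (Matrix (Fin 3) (Fin 3) ℂ) (principalSeries 0 0).V) where
  length := 4
  toFun := ![⊥, span00Vertex, span00Row, span00Row ⊔ span00Col, ⊤]
  step i := by
    fin_cases i
    · exact bot_covBy_span00Vertex
    · exact span00Vertex_covBy_span00Row
    · exact span00Row_covBy_sup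
    · exact span00_sup_covBy_top

/-- `rhoCompositionSeries` starts at `0` [cite: BorelWallach2000, VI 4.10 (10)] -/
theorem rhoCompositionSeries_head : rhoCompositionSeries.head = ⊥ := rfl

/-- `rhoCompositionSeries` ends at `V(0,0)` [cite: BorelWallach2000, VI 4.10 (10)] -/
theorem rhoCompositionSeries_last : rhoCompositionSeries.last = ⊤ := rfl

/-- **Jordan–Hölder for `V(0,0)`: every composition series of `V(0,0)` from `0` to `V(0,0)` is equivalent to
`rhoCompositionSeries`; in particular it has length `4`** (the four cohomological constituents `J_{0,0}, J_{1,0}, J_{0,1},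
D_1` counted with multiplicity). [cite: BorelWallach2000, VI 4.10 (10)] [cite: BourbakiAlgebraI1989, Chap. I §4 no. 7 Thm. 6] -/
theorem principalSeries_zero_zero_compositionSeries_length_eq
    (s : CompositionSeries (LieSubmodule ℂ (Matrix (Fin 3) (Fin 3) ℂ) (principalSeries 0 0).V))
    (hb : s.head = ⊥) (ht : s.last = ⊤) :
    CompositionSeries.Equivalent s rhoCompositionSeries ∧ s.length = 4 := by
  have h := CompositionSeries.jordan_holder s rhoCompositionSeries (hb.trans rhoCompositionSeries_head.symm)
    (ht.trans rhoCompositionSeries_last.symm)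
  exact ⟨h, h.length_eq⟩

/-- `0 ⋖ N_ray` in `V(−3/2,6)` (factor `D_2`) [cite: BorelWallach2000, VI 4.10 (10)] -/
theorem bot_covBy_spanHolRay :
    (⊥ : LieSubmodule ℂ (Matrix (Fin 3) (Fin 3) ℂ) (principalSeries (-3 / 2) 3).V) ⋖ spanHolRay :=
  covBy_of_subquotient_isIrreducible bot_le hol_ray_factor.2.1

/-- `N_ray ⋖ N_strip` (factor `J_{1,0}`) [cite: BorelWallach2000, VI 4.10 (10)] -/
theorem spanHolRay_covBy_spanHolStrip : spanHolRay ⋖ spanHolStrip :=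
  covBy_of_subquotient_isIrreducible spanHolRay_le_spanHolStrip hol_strip_factor.2.1

/-- `N_strip ⋖ V(−3/2,6)` (factor `D_1`) [cite: BorelWallach2000, VI 4.10 (10)] -/
theorem spanHolStrip_covBy_top :
    spanHolStrip ⋖ (⊤ : LieSubmodule ℂ (Matrix (Fin 3) (Fin 3) ℂ) (principalSeries (-3 / 2) 3).V) :=
  covBy_of_subquotient_isIrreducible le_top hol_top_factor.2.1

/-- **The composition series `0 ⋖ N_ray ⋖ N_strip ⋖ V(−3/2,6)`** with factors `D_2, J_{1,0}, D_1`
(`SU21HolomorphicCompositionFactors`). [cite: BorelWallach2000, VI 4.10 (10)] [cite: Kovacevic2021, §4] -/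
def holCompositionSeries :
    CompositionSeries (LieSubmodule ℂ (Matrix (Fin 3) (Fin 3) ℂ) (principalSeries (-3 / 2) 3).V) where
  length := 3
  toFun := ![⊥, spanHolRay, spanHolStrip, ⊤]
  step i := by
    fin_cases i
    · exact bot_covBy_spanHolRay
    · exact spanHolRay_covBy_spanHolStrip
    · exact spanHolStrip_covBy_top

/-- **Jordan–Hölder for `V(−3/2,6)`**: every composition series from `0` to `V(−3/2,6)` is equivalent to
`holCompositionSeries` and has length `3`. [cite: BorelWallach2000, VI 4.10 (10)] [cite: BourbakiAlgebraI1989, Chap. I §4 no. 7 Thm. 6] -/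
theorem principalSeries_hol_compositionSeries_length_eq
    (s : CompositionSeries (LieSubmodule ℂ (Matrix (Fin 3) (Fin 3) ℂ) (principalSeries (-3 / 2) 3).V))
    (hb : s.head = ⊥) (ht : s.last = ⊤) :
    CompositionSeries.Equivalent s holCompositionSeries ∧ s.length = 3 := by
  have h := CompositionSeries.jordan_holder s holCompositionSeries (hb.trans (rfl : holCompositionSeries.head = ⊥).symm)
    (ht.trans (rfl : holCompositionSeries.last = ⊤).symm)
  exact ⟨h, h.length_eq⟩

/-- `0 ⋖ N_ray'` in `V(−3/2,−6)` (factor `D_0`) [cite: BorelWallach2000, VI 4.10 (10)] -/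
theorem bot_covBy_spanAntiholRay :
    (⊥ : LieSubmodule ℂ (Matrix (Fin 3) (Fin 3) ℂ) (principalSeries (-3 / 2) (-3)).V) ⋖ spanAntiholRay :=
  covBy_of_subquotient_isIrreducible bot_le antihol_ray_factor.2.1

/-- `N_ray' ⋖ N_strip'` (factor `J_{0,1}`) [cite: BorelWallach2000, VI 4.10 (10)] -/
theorem spanAntiholRay_covBy_spanAntiholStrip : spanAntiholRay ⋖ spanAntiholStrip :=
  covBy_of_subquotient_isIrreducible spanAntiholRay_le_spanAntiholStrip antihol_strip_factor.2.1

/-- `N_strip' ⋖ V(−3/2,−6)` (factor `D_1`) [cite: BorelWallach2000, VI 4.10 (10)] -/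
theorem spanAntiholStrip_covBy_top :
    spanAntiholStrip ⋖ (⊤ : LieSubmodule ℂ (Matrix (Fin 3) (Fin 3) ℂ) (principalSeries (-3 / 2) (-3)).V) :=
  covBy_of_subquotient_isIrreducible le_top antihol_top_factor.2.1

/-- **The composition series `0 ⋖ N_ray' ⋖ N_strip' ⋖ V(−3/2,−6)`** with factors `D_0, J_{0,1}, D_1`.
[cite: BorelWallach2000, VI 4.10 (10)] [cite: Kovacevic2021, §4] -/
def antiholCompositionSeries :
    CompositionSeries (LieSubmodule ℂ (Matrix (Fin 3) (Fin 3) ℂ) (principalSeries (-3 / 2) (-3)).V) where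
  length := 3
  toFun := ![⊥, spanAntiholRay, spanAntiholStrip, ⊤]
  step i := by
    fin_cases i
    · exact bot_covBy_spanAntiholRay
    · exact spanAntiholRay_covBy_spanAntiholStrip
    · exact spanAntiholStrip_covBy_top

/-- **Jordan–Hölder for `V(−3/2,−6)`**: every composition series from `0` to `V(−3/2,−6)` is equivalent to
`antiholCompositionSeries` and has length `3`. [cite: BorelWallach2000, VI 4.10 (10)] [cite: BourbakiAlgebraI1989, Chap. I §4 no. 7 Thm. 6] -/
theorem principalSeries_antihol_compositionSeries_length_eq
    (s : CompositionSeries (LieSubmodule ℂ (Matrix (Fin 3) (Fin 3) ℂ) (principalSeries (-3 / 2) (-3)).V))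
    (hb : s.head = ⊥) (ht : s.last = ⊤) :
    CompositionSeries.Equivalent s antiholCompositionSeries ∧ s.length = 3 := by
  have h := CompositionSeries.jordan_holder s antiholCompositionSeries
    (hb.trans (rfl : antiholCompositionSeries.head = ⊥).symm) (ht.trans (rfl : antiholCompositionSeries.last = ⊤).symm)
  exact ⟨h, h.length_eq⟩

end SU21Datum

end Literature.RepresentationTheory.Kovacevic2021
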